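import Mathlib
import HarnessLib
import Summits.RiemannHypothesis.Statement
import Summits.RiemannHypothesis.RiemannHypothesis.Theses.MayerPairing
import Summits.RiemannHypothesis.RiemannHypothesis.Theorems.MayerPairingNontrivialZeroLocus
import Summits.RiemannHypothesis.RiemannHypothesis.Theorems.MayerPairingEigenvalueConj
import Summits.RiemannHypothesis.RiemannHypothesis.Theorems.MayerPairingTarget

/-!
# RiemannHypothesis / MayerPairing — the pairing crux on the critical line is the dictionary

Route `RiemannHypothesis/MayerPairing`, item stmt-RiemannHypothesis-1473 (`Target =
UnitCircleCrossedOnce ∧ BranchPairing`), helper file (supports 1473; concerns its second conjunct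
`BranchPairing`, item 1471, and the dictionary `EisensteinEigenvalueOne`, item 1469).

* `mayerPairing_dictionaryOnLine_of_branchPairing` : for a zero `ρ` ON the critical line with
  `Im ρ > 14`, `BranchPairing` degenerates to the dictionary statement "`1` is an eigenvalue of
  Mayer's `L_{ρ/2}`" (the pairing segment is the point `σ = 1/4` and `Λ (1/4) = 1`);
* `mayerPairing_eisensteinEigenvalueOne_of_riemannHypothesis` : under RH every zero of `ζ (2 s)`
  with `0 < Re s < 1/2` is such a `ρ = 2 s` or its conjugate (in-tree zero-locus bookkeeping and
  the conjugation symmetry of the eigenvalue predicate), so `RH → BranchPairing →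
  EisensteinEigenvalueOne`;
* `mayerPairing_branchPairing_iff_dictionary_of_riemannHypothesis` : together with the in-tree
  converse `mayerPairing_branchPairing_of_riemannHypothesis`, **modulo RH the pairing crux is
  exactly the dictionary**: `RH → (BranchPairing ↔ EisensteinEigenvalueOne)`.

So `BranchPairing` = (Chang–Mayer dictionary on the line) ∧ (a pairing claim about off-line zeros,
vacuous under RH) — the kernel-checked form of the refuters' reading of item 1471. Mathlib-only apart
from the route files. References: C.-H. Chang and D. Mayer, Contemp. Math. 290 (2001), Prop. 4.1(v);
I. Efrat, Invent. Math. 114 (1993) 207–218.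
-/

namespace Summit.RiemannHypothesis.RiemannHypothesis.Theorems

open Filter Topology
open scoped ComplexConjugate
open Summit.RiemannHypothesis.RiemannHypothesis.Theses.MayerPairing

/-- **On the critical line the pairing crux is the dictionary.** If `BranchPairing` holds, then for
every zero `ρ` of `ζ` with `Re ρ = 1/2` and `Im ρ > 14` the number `1` is an eigenvalue of Mayer's
`L_{ρ/2}` in the route's inlined functional-equation sense: the pairing segment
`[Re ρ/2, (1 - Re ρ)/2]` is the single point `1/4`, where the selection takes the value `1`.
[folklore] -/
theorem mayerPairing_dictionaryOnLine_of_branchPairing (hB : BranchPairing) :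
    ∀ ρ : ℂ, riemannZeta ρ = 0 → ρ.re = 1 / 2 → 14 < ρ.im →
      ∃ f : ℂ → ℂ, ∃ δ : ℝ, 0 < δ ∧ DifferentiableOn ℂ f {z : ℂ | -δ < z.re} ∧
        (∃ z : ℂ, 0 < z.re ∧ f z ≠ 0) ∧
        (∀ z : ℂ, -δ < z.re → (1 : ℂ) * (f z - f (z + 1)) =
          (z + 1) ^ (-(2 * (ρ / 2))) * f (1 / (z + 1))) ∧
        Tendsto (fun x : ℝ => (1 : ℂ) * f x -
          f 0 * ((x : ℂ) + 1) ^ (1 - 2 * (ρ / 2)) / (2 * (ρ / 2) - 1)) atTop (𝓝 0) := by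
  intro ρ hζ hline h14
  obtain ⟨Λ, _, ha, _, heig⟩ := hB ρ hζ (by rw [hline]; norm_num) (le_of_eq hline) h14
  have hmem : ρ.re / 2 ∈ Set.Icc (ρ.re / 2) ((1 - ρ.re) / 2) :=
    ⟨le_rfl, by rw [hline]; norm_num⟩
  obtain ⟨f, δ, hδ, hdiff, hnz, hfe, hlim⟩ := heig (ρ.re / 2) hmem
  have hs : ((ρ.re / 2 : ℝ) : ℂ) + ((ρ.im / 2 : ℝ) : ℂ) * Complex.I = ρ / 2 := by
    apply Complex.ext <;> simp
  rw [ha] at hfe hlim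
  simp only [hs] at hfe hlim
  exact ⟨f, δ, hδ, hdiff, hnz, hfe, hlim⟩

/-- **Under RH, the pairing crux implies the dictionary.** Assume the Riemann Hypothesis and
`BranchPairing`, and let `0 < Re s < 1/2` with `ζ (2 s) = 0`. Then `2 s` is a non-trivial zero, so
`Re (2 s) = 1/2` (RH) and `|Im (2 s)| > 14` (`mayerPairing_nontrivialZeroLocus`); if `Im (2 s) > 14`
the previous lemma at `ρ = 2 s` gives the eigenvalue `1` of `L_s`, and if `Im (2 s) < -14` it gives
the eigenvalue `1` of `L_{conj s}`, which conjugates back to `L_s` by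
`mayerPairing_eigenvalue_conj`. [folklore] -/
theorem mayerPairing_eisensteinEigenvalueOne_of_riemannHypothesis
    (hRH : _root_.Summit.RiemannHypothesis) (hB : BranchPairing) : EisensteinEigenvalueOne := by
  intro s hs0 hs1 hζ
  -- `2 s` is a non-trivial zero, hence on the line and above height 14 in absolute value
  have htriv : ¬ ∃ n : ℕ, 2 * s = -2 * (n + 1) := by
    rintro ⟨n, hn⟩
    have hre : (2 * s).re = -2 * (n + 1) := by
      rw [hn]
      simp
    have h2 : (2 * s).re = 2 * s.re := by simp
    have hn0 : (0 : ℝ) ≤ n := n.cast_nonneg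
    linarith
  have hne1 : 2 * s ≠ 1 := by
    intro h1
    have h2 : (2 * s).re = 2 * s.re := by simp
    rw [h1, Complex.one_re] at h2
    linarith
  have hline : (2 * s).re = 1 / 2 := hRH (2 * s) hζ htriv hne1
  obtain ⟨_, _, him⟩ := mayerPairing_nontrivialZeroLocus (2 * s) hζ htriv hne1
  rcases lt_or_ge 0 (2 * s).im with hpos | hnonpos
  · -- upper half-plane: the dictionary at `ρ = 2 s`
    have h14 : 14 < (2 * s).im := by rwa [abs_of_pos hpos] at him
    have h := mayerPairing_dictionaryOnLine_of_branchPairing hB (2 * s) hζ hline h14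
    have hs2 : 2 * s / 2 = s := by ring
    simp only [hs2] at h
    exact h
  · -- lower half-plane: the dictionary at `conj (2 s)`, conjugated back
    have hconj : riemannZeta (conj (2 * s)) = 0 := by
      rw [riemannZeta_conj, hζ, map_zero]
    have hline' : (conj (2 * s)).re = 1 / 2 := by rwa [Complex.conj_re]
    have h14' : 14 < (conj (2 * s)).im := by
      rw [Complex.conj_im]
      rwa [abs_of_nonpos hnonpos] at him
    have h := mayerPairing_dictionaryOnLine_of_branchPairing hB (conj (2 * s)) hconj hline' h14'
    -- `conj (2 s) / 2 = s.re + (-s.im) i`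
    have hpt : conj (2 * s) / 2 = ((s.re : ℝ) : ℂ) + ((-s.im : ℝ) : ℂ) * Complex.I := by
      apply Complex.ext
      · simp
      · simp
        ring
    simp only [hpt] at h
    have h' := mayerPairing_eigenvalue_conj s.re (-s.im) 1 h
    -- back to `s = s.re + s.im i`, eigenvalue `conj 1 = 1`
    have hpt' : ((s.re : ℝ) : ℂ) + ((-(-s.im) : ℝ) : ℂ) * Complex.I = s := by
      apply Complex.ext <;> simp
    simp only [hpt', map_one] at h'
    exact h'

/-- **Modulo RH, the pairing crux is exactly the dictionary.** Under the Riemann Hypothesis,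
`BranchPairing ↔ EisensteinEigenvalueOne`: forward by
`mayerPairing_eisensteinEigenvalueOne_of_riemannHypothesis`, backward by the in-tree
`mayerPairing_branchPairing_of_riemannHypothesis` (every pairing segment degenerates to `σ = 1/4`,
where the dictionary supplies the eigenvalue `1`). [folklore] -/
theorem mayerPairing_branchPairing_iff_dictionary_of_riemannHypothesis
    (hRH : _root_.Summit.RiemannHypothesis) : BranchPairing ↔ EisensteinEigenvalueOne :=
  ⟨mayerPairing_eisensteinEigenvalueOne_of_riemannHypothesis hRH,
    fun hD => mayerPairing_branchPairing_of_riemannHypothesis hD hRH⟩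

end Summit.RiemannHypothesis.RiemannHypothesis.Theorems
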